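import Literature.NumberTheory.EllipticCurves.NeronSigmaFunctionAnalyticProofs
import Literature.NumberTheory.EllipticCurves.WeierstrassAdditionProofs
import Literature.NumberTheory.EllipticCurves.WeierstrassSigmaDivision
import Literature.NumberTheory.Transcendental.KontsevichZagierEllipticLiftProofs
import Literature.NumberTheory.Transcendental.SigmaJets
import Summits.KontsevichZagierPeriods.KontsevichZagierPeriods.Theorems.TorsionLogsNeronTorsionSectorStubRealDictionary
import Summits.KontsevichZagierPeriods.KontsevichZagierPeriods.Theorems.SymplecticScissorsRealOnePeriodRelationsStubTorsUnitSigma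

/-!
# Real-axis calculus of `ζ` and `log ‖σ‖` for a real lattice (Néron duplication, part 1)

Support file for the crux `TorsionLogs.NeronTorsionFlex` (stmt-KontsevichZagierPeriods-13806),
line `NeronDuplication`: the on-path lemma `KontsevichZagierPeriods → NeronDuplicationChain` needs
the classical duplication formula of the archimedean Néron function read as a VALUE identity between
the four integral representations of the rung. This file supplies the real-variable dictionary for
the Weierstrass `ζ`- and `σ`-functions of a real lattice `Λ` (least positive real period `Ω₀`,
`X = ℘|ℝ`, `Y = ℘′|ℝ`, `e₁ = X(Ω₀/2)`):

* `(Re ζ)′ = −X` and `(log ‖σ‖)′ = Re ζ` on `ℝ ∖ Λ`;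
* `∫_a^b X = Re ζ(a) − Re ζ(b)` and `∫_a^b (Re ζ − c) = log‖σ(b)‖ − log‖σ(a)‖ − c(b − a)` on
  `0 < a ≤ b < Ω₀`;
* the incomplete integral of the second kind `∫_{e₁}^{X w} x dx/√f = Re ζ(w) − Re ζ(Ω₀/2)` and the
  iterated integral `∫_{e₁}^{X u} (∫_{e₁}^{x} x′dx′/√f) dx/√f = log‖σ(Ω₀/2)‖ − log‖σ(u)‖ −
  Re ζ(Ω₀/2)(Ω₀/2 − u)`;
* `log‖σ(2u)‖ = log|Y u| + 4 log‖σ u‖` (`σ(2z) = −℘′(z)σ(z)⁴`), the reflection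
  `log‖σ(Ω₀ − s)‖ = log‖σ s‖ − η(s − Ω₀/2)` with `η = Re η(Ω₀) = 2 Re ζ(Ω₀/2)`, and the constant
  `4 log‖σ(Ω₀/2)‖ + log(3e₁² − g₂/4) = ηΩ₀/2` (from `℘(Ω₀/4) − e₁ = e^{ηΩ₀/4}/σ(Ω₀/2)²` and
  `(X(Ω₀/4) − e₁)² = 3e₁² − g₂/4`).

Everything is read off the tree's complex theory (`WeierstrassSigmaProofs`, `WeierstrassSigmaDivision`,
`WeierstrassAdditionProofs`, `NeronSigmaFunctionAnalyticProofs`) and the real dictionary of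
`TorsionLogsNeronTorsionSectorStubRealDictionary`. References: Whittaker–Watson (1927) §§20.4–20.53;
Silverman, *Advanced Topics* (1994), VI §3; Lawden (1989), §6.
-/

-- single-conjunct summit: Sub = Summit, so the namespace segment repeats by design (CONVENTIONS §2)
set_option linter.dupNamespace false

noncomputable section

open Set MeasureTheory Filter Topology Complex
open scoped PeriodPair ComplexConjugate

namespace Summit.KontsevichZagierPeriods.KontsevichZagierPeriods.TorsionLogs.NeronDuplication

variable {L : PeriodPair}

/-! ### Derivatives on the real axis -/

/-- On the real axis, `(Re ζ)′(t) = −X(t)` at real non-lattice points. [folklore] -/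
theorem hasDerivAt_re_weierstrassZeta {t : ℝ} (ht : (t : ℂ) ∉ L.lattice) :
    HasDerivAt (fun s : ℝ => (L.weierstrassZeta s).re) (-L.weierstrassPRe t) t := by
  have h := (PeriodPair.hasDerivAt_weierstrassZeta ht).real_of_complex
  rw [Complex.neg_re, ← PeriodPair.weierstrassPRe_def] at h
  exact h

/-- On the real axis, `(log ‖σ‖)′(t) = Re ζ(t)` at real non-lattice points (`σ′/σ = ζ`).
[folklore] -/
theorem hasDerivAt_log_norm_weierstrassSigma {t : ℝ} (ht : (t : ℂ) ∉ L.lattice) :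
    HasDerivAt (fun s : ℝ => Real.log ‖L.weierstrassSigma s‖) ((L.weierstrassZeta t).re) t := by
  have hσ0 : L.weierstrassSigma t ≠ 0 := L.weierstrassSigma_ne_zero ht
  have h1 : HasDerivAt (fun s : ℝ => L.weierstrassSigma s)
      (L.weierstrassZeta t * L.weierstrassSigma t) t :=
    (Summit.KontsevichZagierPeriods.SymplecticScissors.RealOnePeriodRelations.TorsionLayer.hasDerivAt_weierstrassSigma_eq_zeta_mul
      L ht).comp_ofReal
  have h2 := h1.norm_sq
  have hn0 : ‖L.weierstrassSigma t‖ ^ 2 ≠ 0 := pow_ne_zero 2 (norm_ne_zero_iff.mpr hσ0)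
  have h3 := h2.log hn0
  have h4 := h3.const_mul (1 / 2 : ℝ)
  have e1 : (fun s : ℝ => 1 / 2 * Real.log (‖L.weierstrassSigma s‖ ^ 2)) =
      fun s : ℝ => Real.log ‖L.weierstrassSigma s‖ := by
    funext s
    rw [Real.log_pow]
    push_cast
    ring
  rw [e1] at h4
  have e2 : 1 / 2 * (2 * inner ℝ (L.weierstrassSigma t) (L.weierstrassZeta t * L.weierstrassSigma t) /
      ‖L.weierstrassSigma ↑t‖ ^ 2) = (L.weierstrassZeta t).re := by
    rw [Complex.inner, mul_assoc, Complex.mul_conj, Complex.re_mul_ofReal, Complex.normSq_eq_norm_sq]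
    field_simp
  rw [e2] at h4
  exact h4


/-! ### Fundamental theorem of calculus on real period intervals -/

/-- Real points of `(0, Ω₀)` are not lattice points. [folklore] -/
theorem notMem_of_mem_Ioo (hR : L.IsReal) {t : ℝ} (ht : t ∈ Ioo 0 L.minRealPeriod) :
    (t : ℂ) ∉ L.lattice :=
  hR.ofReal_notMem_lattice ht.1 ht.2

/-- `∫_a^b X = Re ζ(a) − Re ζ(b)` for `0 < a ≤ b < Ω₀` (`ζ′ = −℘`, Whittaker–Watson §20.4). [folklore] -/
theorem integral_weierstrassPRe_Ioo (hR : L.IsReal) {a b : ℝ} (ha : 0 < a) (hab : a ≤ b)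
    (hb : b < L.minRealPeriod) :
    ∫ v in Ioo a b, L.weierstrassPRe v = (L.weierstrassZeta a).re - (L.weierstrassZeta b).re := by
  have hnot : ∀ s ∈ uIcc a b, (s : ℂ) ∉ L.lattice := by
    intro s hs
    rw [uIcc_of_le hab] at hs
    exact hR.ofReal_notMem_lattice (by linarith [hs.1]) (by linarith [hs.2])
  have hderiv : ∀ s ∈ uIcc a b,
      HasDerivAt (fun x : ℝ => -(L.weierstrassZeta x).re) (L.weierstrassPRe s) s := by
    intro s hs
    have h := (hasDerivAt_re_weierstrassZeta (hnot s hs)).neg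
    rw [neg_neg] at h
    exact h
  have hcont : ContinuousOn L.weierstrassPRe (uIcc a b) := fun s hs =>
    (PeriodPair.continuousAt_weierstrassPRe (hnot s hs)).continuousWithinAt
  have key := intervalIntegral.integral_eq_sub_of_hasDerivAt hderiv (hcont.intervalIntegrable)
  rw [intervalIntegral.integral_of_le hab, integral_Ioc_eq_integral_Ioo] at key
  rw [key]
  ring

/-- `∫_a^b (Re ζ − c) = log‖σ(b)‖ − log‖σ(a)‖ − c(b − a)` for `0 < a ≤ b < Ω₀` (`(log σ)′ = ζ`,
Whittaker–Watson §20.42). [folklore] -/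
theorem integral_re_weierstrassZeta_sub_const_Ioo (hR : L.IsReal) {a b : ℝ} (ha : 0 < a)
    (hab : a ≤ b) (hb : b < L.minRealPeriod) (c : ℝ) :
    ∫ w in Ioo a b, ((L.weierstrassZeta w).re - c) =
      Real.log ‖L.weierstrassSigma b‖ - Real.log ‖L.weierstrassSigma a‖ - c * (b - a) := by
  have hnot : ∀ s ∈ uIcc a b, (s : ℂ) ∉ L.lattice := by
    intro s hs
    rw [uIcc_of_le hab] at hs
    exact hR.ofReal_notMem_lattice (by linarith [hs.1]) (by linarith [hs.2])
  have hderiv : ∀ s ∈ uIcc a b,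
      HasDerivAt (fun x : ℝ => Real.log ‖L.weierstrassSigma x‖ - c * x)
        ((L.weierstrassZeta s).re - c) s := by
    intro s hs
    have h := (hasDerivAt_log_norm_weierstrassSigma (hnot s hs)).sub
      ((hasDerivAt_id s).const_mul c)
    rw [mul_one] at h
    exact h
  have hcont : ContinuousOn (fun s : ℝ => (L.weierstrassZeta s).re - c) (uIcc a b) := fun s hs =>
    ((hasDerivAt_re_weierstrassZeta (hnot s hs)).continuousAt.sub continuousAt_const).continuousWithinAt
  have key := intervalIntegral.integral_eq_sub_of_hasDerivAt hderiv (hcont.intervalIntegrable)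
  rw [intervalIntegral.integral_of_le hab, integral_Ioc_eq_integral_Ioo] at key
  rw [key]
  ring

/-! ### Elliptic integrals of the second kind on the unbounded real component -/

/-- The image of `(w, Ω₀/2)` under `X` is `(e₁, X w)` for `w ∈ (0, Ω₀/2)` (`X` is continuous and
strictly decreasing on `(0, Ω₀/2]` onto `[e₁, ∞)`). [folklore] -/
theorem image_weierstrassPRe_Ioo_half (hR : L.IsReal) {w : ℝ}
    (hw : w ∈ Ioo 0 (L.minRealPeriod / 2)) :
    L.weierstrassPRe '' Ioo w (L.minRealPeriod / 2) =
      Ioo (L.weierstrassPRe (L.minRealPeriod / 2)) (L.weierstrassPRe w) := by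
  have hΩ := hR.minRealPeriod_pos
  have hanti := hR.strictAntiOn_weierstrassPRe
  apply Subset.antisymm
  · rintro _ ⟨s, hs, rfl⟩
    exact ⟨hanti ⟨hw.1.trans hs.1, hs.2.le⟩ ⟨by linarith, le_rfl⟩ hs.2,
      hanti ⟨hw.1, hw.2.le⟩ ⟨hw.1.trans hs.1, hs.2.le⟩ hs.1⟩
  · intro x hx
    have hx' : x ∈ Ioi (L.weierstrassPRe (L.minRealPeriod / 2)) := hx.1
    rw [← hR.image_weierstrassPRe_Ioo] at hx'
    obtain ⟨s, hs, rfl⟩ := hx'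
    refine ⟨s, ⟨?_, hs.2⟩, rfl⟩
    by_contra hsw
    push Not at hsw
    exact (not_lt.mpr (hanti.antitoneOn ⟨hs.1, hs.2.le⟩ ⟨hw.1, hw.2.le⟩ hsw)) hx.2

/-- **Incomplete integral of the second kind**: for `w ∈ (0, Ω₀/2)`,
`∫_{e₁}^{X w} x dx/√(4x³ − g₂x − g₃) = Re ζ(w) − Re ζ(Ω₀/2)` (substitute `x = X(v)`, `v ∈ (w, Ω₀/2)`,
`|X′|/√f(X) = 1`, then `∫ ℘ = −ζ`; Whittaker–Watson §20.4, Lawden §6.12). [folklore] -/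
theorem integral_mul_inv_sqrt_Ioo_weierstrassPRe (hR : L.IsReal) {w : ℝ}
    (hw : w ∈ Ioo 0 (L.minRealPeriod / 2)) :
    ∫ x in Ioo (L.weierstrassPRe (L.minRealPeriod / 2)) (L.weierstrassPRe w),
        x / Real.sqrt (4 * x ^ 3 - L.g₂.re * x - L.g₃.re) =
      (L.weierstrassZeta w).re - (L.weierstrassZeta ((L.minRealPeriod / 2 : ℝ) : ℂ)).re := by
  have hΩ := hR.minRealPeriod_pos
  have hanti := hR.strictAntiOn_weierstrassPRe
  have hnot : ∀ s ∈ Ioo w (L.minRealPeriod / 2), (s : ℂ) ∉ L.lattice :=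
    fun s hs ↦ hR.ofReal_notMem_lattice (hw.1.trans hs.1) (by linarith [hs.2])
  have hsub : Ioo w (L.minRealPeriod / 2) ⊆ Ioc 0 (L.minRealPeriod / 2) :=
    fun s hs => ⟨hw.1.trans hs.1, hs.2.le⟩
  have hinj : InjOn L.weierstrassPRe (Ioo w (L.minRealPeriod / 2)) := hanti.injOn.mono hsub
  rw [← image_weierstrassPRe_Ioo_half hR hw, integral_image_eq_integral_abs_deriv_smul
    measurableSet_Ioo (fun s hs ↦ (PeriodPair.hasDerivAt_weierstrassPRe (hnot s hs)).hasDerivWithinAt)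
    hinj]
  have heq : EqOn (fun s ↦ |L.derivWeierstrassPRe s| •
      (L.weierstrassPRe s / Real.sqrt (4 * L.weierstrassPRe s ^ 3 - L.g₂.re * L.weierstrassPRe s
        - L.g₃.re))) (fun s ↦ L.weierstrassPRe s) (Ioo w (L.minRealPeriod / 2)) := by
    intro s hs
    simp only [smul_eq_mul]
    have hY : L.derivWeierstrassPRe s ≠ 0 :=
      (hR.derivWeierstrassPRe_neg (hw.1.trans hs.1) (by linarith [hs.2])).ne
    rw [← hR.derivWeierstrassPRe_sq (hnot s hs), Real.sqrt_sq_eq_abs]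
    field_simp
  rw [setIntegral_congr_fun measurableSet_Ioo heq,
    integral_weierstrassPRe_Ioo hR hw.1 hw.2.le (by linarith)]

/-- **The iterated integral of the rung** (the archimedean Néron function as a double integral):
for `u ∈ (0, Ω₀/2)`,
`∫_{e₁}^{X u} (∫_{e₁}^{x} x′ dx′/√f(x′)) dx/√f(x) = log‖σ(Ω₀/2)‖ − log‖σ(u)‖ − Re ζ(Ω₀/2)·(Ω₀/2 − u)`
(outer substitution `x = X(w)`, inner integral `= Re ζ(w) − Re ζ(Ω₀/2)`, then `(log σ)′ = ζ`).
[folklore] -/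
theorem iterated_integral_weierstrassPRe (hR : L.IsReal) {u : ℝ}
    (hu : u ∈ Ioo 0 (L.minRealPeriod / 2)) :
    ∫ x in Ioo (L.weierstrassPRe (L.minRealPeriod / 2)) (L.weierstrassPRe u),
        (∫ y in Ioo (L.weierstrassPRe (L.minRealPeriod / 2)) x,
          y / Real.sqrt (4 * y ^ 3 - L.g₂.re * y - L.g₃.re)) *
        (Real.sqrt (4 * x ^ 3 - L.g₂.re * x - L.g₃.re))⁻¹ =
      Real.log ‖L.weierstrassSigma ((L.minRealPeriod / 2 : ℝ) : ℂ)‖ - Real.log ‖L.weierstrassSigma u‖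
        - (L.weierstrassZeta ((L.minRealPeriod / 2 : ℝ) : ℂ)).re * (L.minRealPeriod / 2 - u) := by
  have hΩ := hR.minRealPeriod_pos
  have hanti := hR.strictAntiOn_weierstrassPRe
  have hnot : ∀ s ∈ Ioo u (L.minRealPeriod / 2), (s : ℂ) ∉ L.lattice :=
    fun s hs ↦ hR.ofReal_notMem_lattice (hu.1.trans hs.1) (by linarith [hs.2])
  have hsub : Ioo u (L.minRealPeriod / 2) ⊆ Ioc 0 (L.minRealPeriod / 2) :=
    fun s hs => ⟨hu.1.trans hs.1, hs.2.le⟩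
  have hinj : InjOn L.weierstrassPRe (Ioo u (L.minRealPeriod / 2)) := hanti.injOn.mono hsub
  rw [← image_weierstrassPRe_Ioo_half hR hu, integral_image_eq_integral_abs_deriv_smul
    measurableSet_Ioo (fun s hs ↦ (PeriodPair.hasDerivAt_weierstrassPRe (hnot s hs)).hasDerivWithinAt)
    hinj]
  have heq : EqOn (fun s ↦ |L.derivWeierstrassPRe s| •
      ((∫ y in Ioo (L.weierstrassPRe (L.minRealPeriod / 2)) (L.weierstrassPRe s),
          y / Real.sqrt (4 * y ^ 3 - L.g₂.re * y - L.g₃.re)) *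
        (Real.sqrt (4 * L.weierstrassPRe s ^ 3 - L.g₂.re * L.weierstrassPRe s - L.g₃.re))⁻¹))
      (fun s ↦ (L.weierstrassZeta s).re - (L.weierstrassZeta ((L.minRealPeriod / 2 : ℝ) : ℂ)).re)
      (Ioo u (L.minRealPeriod / 2)) := by
    intro s hs
    simp only [smul_eq_mul]
    have hs' : s ∈ Ioo 0 (L.minRealPeriod / 2) := ⟨hu.1.trans hs.1, hs.2⟩
    have hY : L.derivWeierstrassPRe s ≠ 0 :=
      (hR.derivWeierstrassPRe_neg hs'.1 (by linarith [hs.2])).ne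
    rw [integral_mul_inv_sqrt_Ioo_weierstrassPRe hR hs', ← hR.derivWeierstrassPRe_sq (hnot s hs),
      Real.sqrt_sq_eq_abs]
    field_simp
  rw [setIntegral_congr_fun measurableSet_Ioo heq,
    integral_re_weierstrassZeta_sub_const_Ioo hR hu.1 hu.2.le (by linarith)]


/-! ### Norm identities for `σ` on the real axis -/

open Summit.KontsevichZagierPeriods.KontsevichZagierPeriods.Cruxes.NeronTorsionSector.Translation
  (two_mul_ofReal_notMem_lattice)

/-- **Duplication in absolute value**: `log‖σ(2u)‖ = log|Y u| + 4 log‖σ(u)‖` for real `u ∈ (0, Ω₀)`,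
`u ≠ Ω₀/2` (`σ(2z) = −℘′(z)σ(z)⁴`, Whittaker–Watson §20.53 Example 1). [folklore] -/
theorem log_norm_weierstrassSigma_two_mul (hR : L.IsReal) {u : ℝ} (hu : u ∈ Ioo 0 L.minRealPeriod)
    (hne : u ≠ L.minRealPeriod / 2) :
    Real.log ‖L.weierstrassSigma ((2 * u : ℝ) : ℂ)‖ =
      Real.log |L.derivWeierstrassPRe u| + 4 * Real.log ‖L.weierstrassSigma u‖ := by
  have hu' : (u : ℂ) ∉ L.lattice := hR.ofReal_notMem_lattice hu.1 hu.2
  have h2u : 2 * (u : ℂ) ∉ L.lattice := two_mul_ofReal_notMem_lattice hR hu hne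
  have hY : L.derivWeierstrassPRe u ≠ 0 := by
    intro h0
    apply h2u
    apply L.two_mul_mem_lattice_of_derivWeierstrassP_eq_zero hu'
    rw [← hR.ofReal_derivWeierstrassPRe, h0, Complex.ofReal_zero]
  have hσ : ‖L.weierstrassSigma u‖ ≠ 0 := norm_ne_zero_iff.mpr (L.weierstrassSigma_ne_zero hu')
  have h := L.weierstrassSigma_two_mul hu'
  rw [← hR.ofReal_derivWeierstrassPRe] at h
  push_cast
  rw [h, norm_mul, norm_neg, norm_pow, Complex.norm_real, Real.norm_eq_abs,
    Real.log_mul (abs_ne_zero.mpr hY) (pow_ne_zero 4 hσ), Real.log_pow]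
  push_cast
  ring

/-- **The quasi-period of the real period**: `η(Ω₀) = 2ζ(Ω₀/2)` (write `Ω₀ = mω₁ + nω₂`; both sides
equal `mη₁ + nη₂`, Whittaker–Watson §20.41). [folklore] -/
theorem quasiPeriodMap_minRealPeriod (hR : L.IsReal) :
    L.quasiPeriodMap L.minRealPeriod = 2 * L.weierstrassZeta ((L.minRealPeriod / 2 : ℝ) : ℂ) := by
  obtain ⟨m, n, hmn⟩ := PeriodPair.mem_lattice.1 hR.minRealPeriod_mem_lattice
  have h1 := L.quasiPeriodMap_smul_add_smul m n
  push_cast at h1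
  have h2 := Literature.NumberTheory.Transcendental.two_mul_weierstrassZeta_half_lattice L m n
  rw [hmn] at h1 h2
  have e : ((L.minRealPeriod / 2 : ℝ) : ℂ) = (L.minRealPeriod : ℂ) / 2 := by push_cast; ring
  rw [e, h2, h1]

/-- **Reflection in absolute value**: `log‖σ(Ω₀ − s)‖ = log‖σ(s)‖ − Re η(Ω₀)·(s − Ω₀/2)` for real
`s ∉ Λ` (quasi-periodicity `|σ(z + ω)| = e^{Re(η(ω)(z + ω/2))}|σ(z)|` and oddness; Silverman ATAEC
Prop. VI.3.1(b)). [folklore] -/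
theorem log_norm_weierstrassSigma_minRealPeriod_sub (hR : L.IsReal) {s : ℝ} (hs : (s : ℂ) ∉ L.lattice) :
    Real.log ‖L.weierstrassSigma ((L.minRealPeriod - s : ℝ) : ℂ)‖ =
      Real.log ‖L.weierstrassSigma s‖ -
        (L.quasiPeriodMap L.minRealPeriod).re * (s - L.minRealPeriod / 2) := by
  have hω := hR.minRealPeriod_mem_lattice
  have hsω : (s : ℂ) - L.minRealPeriod ∉ L.lattice := fun h => hs (by simpa using add_mem h hω)
  have hσ : ‖L.weierstrassSigma ((s : ℂ) - L.minRealPeriod)‖ ≠ 0 :=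
    norm_ne_zero_iff.mpr (L.weierstrassSigma_ne_zero hsω)
  have h := L.norm_weierstrassSigma_add_of_mem hω ((s : ℂ) - L.minRealPeriod)
  rw [sub_add_cancel] at h
  have e1 : ((L.minRealPeriod - s : ℝ) : ℂ) = -((s : ℂ) - L.minRealPeriod) := by push_cast; ring
  have e2 : (L.quasiPeriodMap L.minRealPeriod * ((s : ℂ) - L.minRealPeriod + L.minRealPeriod / 2)).re =
      (L.quasiPeriodMap L.minRealPeriod).re * (s - L.minRealPeriod / 2) := by
    rw [show (s : ℂ) - L.minRealPeriod + L.minRealPeriod / 2 = ((s - L.minRealPeriod / 2 : ℝ) : ℂ) by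
      push_cast; ring, Complex.re_mul_ofReal]
  rw [e1, L.weierstrassSigma_neg, norm_neg, h, Real.log_mul (Real.exp_pos _).ne' hσ, Real.log_exp, e2]
  ring

/-- **The constant of the Néron function at the real 2-torsion point**:
`3e₁² − g₂/4 > 0` and `4 log‖σ(Ω₀/2)‖ + log(3e₁² − g₂/4) = Re η(Ω₀)·Ω₀/2`, `e₁ = X(Ω₀/2)`. Proof: the `σ`-formula
`℘(u) − ℘(v) = −σ(u−v)σ(u+v)/(σ(u)²σ(v)²)` at `u = Ω₀/4`, `v = Ω₀/2` with the quasi-periodicity of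
`|σ|` gives `|X(Ω₀/4) − e₁| = e^{Re η(Ω₀)Ω₀/4}/‖σ(Ω₀/2)‖²`, and the real duplication formula at `Ω₀/4`
(`X(Ω₀/2) = e₁`) gives `(X(Ω₀/4) − e₁)² = 3e₁² − g₂/4` (Whittaker–Watson §20.33). [folklore] -/
theorem four_mul_log_norm_weierstrassSigma_half (hR : L.IsReal) :
    0 < 3 * L.weierstrassPRe (L.minRealPeriod / 2) ^ 2 - L.g₂.re / 4 ∧
    4 * Real.log ‖L.weierstrassSigma ((L.minRealPeriod / 2 : ℝ) : ℂ)‖ +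
        Real.log (3 * L.weierstrassPRe (L.minRealPeriod / 2) ^ 2 - L.g₂.re / 4) =
      (L.quasiPeriodMap L.minRealPeriod).re * (L.minRealPeriod / 2) := by
  have hΩ := hR.minRealPeriod_pos
  have hω := hR.minRealPeriod_mem_lattice
  set e₁ := L.weierstrassPRe (L.minRealPeriod / 2) with he₁
  set x := L.weierstrassPRe (L.minRealPeriod / 4) with hx
  set y := L.derivWeierstrassPRe (L.minRealPeriod / 4) with hy
  set D := 3 * e₁ ^ 2 - L.g₂.re / 4 with hD
  have h4 : L.minRealPeriod / 4 ∈ Ioo 0 L.minRealPeriod := ⟨by positivity, by linarith⟩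
  have h4ne : L.minRealPeriod / 4 ≠ L.minRealPeriod / 2 := by
    intro h; linarith
  have h4' : ((L.minRealPeriod / 4 : ℝ) : ℂ) ∉ L.lattice := hR.ofReal_notMem_lattice h4.1 h4.2
  have h2' : ((L.minRealPeriod / 2 : ℝ) : ℂ) ∉ L.lattice :=
    hR.ofReal_notMem_lattice (by positivity) (by linarith)
  -- the real duplication formula at `Ω₀/4`: `(x - e₁)² = D`
  have hY0 : y ≠ 0 := by
    intro h0
    apply two_mul_ofReal_notMem_lattice hR h4 h4ne
    apply L.two_mul_mem_lattice_of_derivWeierstrassP_eq_zero h4'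
    rw [← hR.ofReal_derivWeierstrassPRe, ← hy, h0, Complex.ofReal_zero]
  have hysq : y ^ 2 = 4 * x ^ 3 - L.g₂.re * x - L.g₃.re := hR.derivWeierstrassPRe_sq h4'
  have he : 4 * e₁ ^ 3 - L.g₂.re * e₁ - L.g₃.re = 0 := by
    have h := hR.derivWeierstrassPRe_sq h2'
    rw [Summit.KontsevichZagierPeriods.KontsevichZagierPeriods.Cruxes.NeronTorsionSector.Translation.derivWeierstrassPRe_half hR] at h
    rw [he₁]
    linarith [h]
  have hdup := (Summit.KontsevichZagierPeriods.KontsevichZagierPeriods.Cruxes.NeronTorsionSector.Translation.weierstrassPRe_two_mul hR h4 h4ne).1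
  rw [show 2 * (L.minRealPeriod / 4) = L.minRealPeriod / 2 by ring, ← he₁, ← hx, ← hy] at hdup
  have hsq : (x - e₁) ^ 2 = D := by
    have h1 : (6 * x ^ 2 - L.g₂.re / 2) ^ 2 / 4 - (2 * x + e₁) * y ^ 2 = 0 := by
      rw [hdup]; field_simp; ring
    rw [hysq, show L.g₃.re = 4 * e₁ ^ 3 - L.g₂.re * e₁ by linarith] at h1
    have h2 : ((x - e₁) ^ 2 - D) ^ 2 = 0 := by
      rw [hD, ← h1]; ring
    have h3 := pow_eq_zero_iff (n := 2) (by norm_num) |>.mp h2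
    linarith
  -- the `σ`-formula at `u = Ω₀/4`, `v = Ω₀/2`, in absolute value
  have hsub := L.weierstrassP_sub_eq_sigma_holds _ _ h4' h2'
  have e3 : ((L.minRealPeriod / 4 : ℝ) : ℂ) + ((L.minRealPeriod / 2 : ℝ) : ℂ) =
      -((L.minRealPeriod / 4 : ℝ) : ℂ) + L.minRealPeriod := by push_cast; ring
  have e4 : ((L.minRealPeriod / 4 : ℝ) : ℂ) - ((L.minRealPeriod / 2 : ℝ) : ℂ) =
      -((L.minRealPeriod / 4 : ℝ) : ℂ) := by push_cast; ring
  have hq := L.norm_weierstrassSigma_add_of_mem hω (-((L.minRealPeriod / 4 : ℝ) : ℂ))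
  have e5 : (L.quasiPeriodMap L.minRealPeriod * (-((L.minRealPeriod / 4 : ℝ) : ℂ) + L.minRealPeriod / 2)).re
      = (L.quasiPeriodMap L.minRealPeriod).re * (L.minRealPeriod / 4) := by
    rw [show -((L.minRealPeriod / 4 : ℝ) : ℂ) + L.minRealPeriod / 2 = ((L.minRealPeriod / 4 : ℝ) : ℂ) by
      push_cast; ring, Complex.re_mul_ofReal]
  rw [e5, L.weierstrassSigma_neg, norm_neg] at hq
  have hσ4 : ‖L.weierstrassSigma ((L.minRealPeriod / 4 : ℝ) : ℂ)‖ ≠ 0 :=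
    norm_ne_zero_iff.mpr (L.weierstrassSigma_ne_zero h4')
  have hσ2 : ‖L.weierstrassSigma ((L.minRealPeriod / 2 : ℝ) : ℂ)‖ ≠ 0 :=
    norm_ne_zero_iff.mpr (L.weierstrassSigma_ne_zero h2')
  have hnorm : |x - e₁| * ‖L.weierstrassSigma ((L.minRealPeriod / 2 : ℝ) : ℂ)‖ ^ 2 =
      Real.exp ((L.quasiPeriodMap L.minRealPeriod).re * (L.minRealPeriod / 4)) := by
    have h := congrArg (fun z : ℂ => ‖z‖) hsub
    simp only [e3, e4, L.weierstrassSigma_neg, norm_div, norm_neg, norm_mul, norm_pow, hq] at h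
    rw [← hR.ofReal_weierstrassPRe, ← hR.ofReal_weierstrassPRe, ← hx, ← he₁, ← Complex.ofReal_sub,
      Complex.norm_real, Real.norm_eq_abs] at h
    rw [h]
    field_simp
  have hpos : 0 < D := by
    rw [← hsq, ← sq_abs]
    have : 0 < |x - e₁| := by
      by_contra hle
      push Not at hle
      have h0 : |x - e₁| = 0 := le_antisymm hle (abs_nonneg _)
      rw [h0, zero_mul] at hnorm
      exact (Real.exp_pos _).ne hnorm
    positivity
  have key : D * ‖L.weierstrassSigma ((L.minRealPeriod / 2 : ℝ) : ℂ)‖ ^ 4 =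
      Real.exp ((L.quasiPeriodMap L.minRealPeriod).re * (L.minRealPeriod / 2)) := by
    rw [← hsq, ← sq_abs, show (L.quasiPeriodMap L.minRealPeriod).re * (L.minRealPeriod / 2) =
      (L.quasiPeriodMap L.minRealPeriod).re * (L.minRealPeriod / 4) +
        (L.quasiPeriodMap L.minRealPeriod).re * (L.minRealPeriod / 4) by ring, Real.exp_add, ← hnorm]
    ring
  have hlog := congrArg Real.log key
  rw [Real.log_mul hpos.ne' (pow_ne_zero 4 hσ2), Real.log_pow, Real.log_exp] at hlog
  simp only [Nat.cast_ofNat] at hlog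
  exact ⟨hpos, by linarith⟩

end Summit.KontsevichZagierPeriods.KontsevichZagierPeriods.TorsionLogs.NeronDuplication

end
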